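import Literature.AlgebraicGeometry.Resolution.WeightedCentreTailedLightFlow
import Literature.AlgebraicGeometry.Resolution.WeightedCentreRZReduction
import HarnessLib

/-!
# THEOREM 𝔉′, base case (H′): a tailed light flow that moves no light slot is impossible on a core-pinned menu
# (engine 1's `W(f)` toy model, RE-DERIVATION-eng1-g44 §3.3 (H′) — an instrument, NOT a resolution theorem)

RE-DERIVATION-eng1-g44 §3.3, step (H′) of THEOREM 𝔉′ ("no tailed light flows"): if the derivation `𝔇` of a tailed light flow
`(𝔇, q)` kills every LIGHT slot, then `𝔇² = 0` on generators (the data `A_x = 𝔇 ε_x` involve light variables only,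
`IsTailedLightFlow.vars_D`), so `Φ(T)(x) = x + T·A_x(ℓ) + T^p·q_x(ℓ)` on the heavy slots and `Φ(T) = id` elsewhere
(`substC_X_eq_of_apply_apply_eq_zero`), and hypothesis (P) must fail at a heavy class of the CORE `h̿ = h|_{ℓ=0}`.  This file
proves it, following the engine's argument with LEMMA L (`WeightedCentreLemmaL`) as the engine:

* UNMIXED forms, direct applications of `LemmaL.eq_zero_of_classPinned`: `IsTailedLightFlow.false_of_tailFree` (`q = 0`:
  `Φ(T) = PolyShift.polyShift (𝔇 ∘ ε)` is a line of rigid translations, `substC_eq_polyShift`) and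
  `IsTailedLightFlow.false_of_pureTail` (`𝔇 = 0` on every slot: `Φ(T)` is the line `ε ↦ ε + T̃·q` read at `T̃ = T^p`,
  `substC_eq_expand_comp_polyShift`, and `T ↦ T^p` is injective) — here the pins are the faces `h|_{≥ w_x}` of LEMMA L;
* the GENERAL (mixed) form `IsTailedLightFlow.false_of_light_fixed`: with `κ :=` the least of the `w_x − θ` (`A_x ≠ 0`) and the
  `(w_x − pθ)/p` (`q_x ≠ 0`), weigh the light slots by `w`, the heavy ones by `0` and `T` by `−κ` (the `Option`-world `optWt`,
  `fullFamily`/`survFamily`/`restFamily`); the leading-form principle L5 (`LeadingForm.weightedHomogeneousComponent_aeval_of_wtGE`)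
  extracts the CORE identity `h̄(survFamily κ) = h̄` for the weight-`0` part `h̄` of `h` (`aeval_survFamily_core`); the survivors at
  level `κ` are of ONE type (`not_both_survivors`: an `A`-survivor weighs `θ + κ ≥ p`, a tail-survivor would weigh `p(θ + κ) ≥ p²
  > p + 1`); so the core identity is a LINE of rigid translations in `T` (`polyShift_core_of_derivSurvivors`) or in `T̃ = T^p`
  (`polyShift_core_of_tailSurvivors`), and LEMMA L at one weight (`LemmaL.component_eq_zero_of_classPinned`, = L6 vertex step +
  I-rigidity) kills the surviving block against the class-pin of the core `killLight (¬ light) h` — a contradiction.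

The steps (L0′) (`WeightedCentreLowestClassKill`) / (L1′) and THEOREM 𝔉′ itself (`TailedLightFlow.NoTailedLightFlow`) are NOT
assembled here.

HONEST FRAMING.  Commutative algebra over a field; an instrument for engine 1's `W(f)` TOY MODEL.  NOT a resolution theorem and NOT
a statement about the invariant of [ATW2024]; [Lang2002, Ch. IV §1, Ch. XIII §4], [Matsumura1987, §27, §25] and [ATW2024, §5.1,
Thm. 5.3.1] are cited for context only.
-/

namespace Literature.AlgebraicGeometry.Resolution.WeightedBlowup

open Polynomial
open scoped Nat

namespace TailedLightFlow

/-! ## `Φ(T) = ε + T·𝔇ε` when `𝔇² = 0` on generators and `q = 0` -/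

section TailFree

variable {k : Type*} [CommRing k] {ι : Type*} (D : Derivation k (MvPolynomial ι k) (MvPolynomial ι k)) (p : ℕ) (u : ℕ → k)
  (q : ι → MvPolynomial ι k)

/-- `𝔇(𝔇 ε_i) = 0 ⟹ 𝔇^n ε_i = 0` for `n ≥ 2` (derived here). [cite: Matsumura1987, §25] -/
theorem iterate_X_eq_zero_of_two_le {i : ι} (h2 : D (D (MvPolynomial.X i)) = 0) {n : ℕ} (hn : 2 ≤ n) :
    D^[n] (MvPolynomial.X i) = 0 := by
  obtain ⟨m, rfl⟩ := Nat.exists_eq_add_of_le hn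
  rw [add_comm, Function.iterate_add_apply, show D^[2] (MvPolynomial.X i) = D (D (MvPolynomial.X i)) from rfl, h2]
  exact Function.iterate_fixed (map_zero D) m

/-- **`Φ(T)(ε_i) = ε_i + T·𝔇 ε_i`** when `𝔇(𝔇 ε_i) = 0` and `q_i = 0` (`u_0 = u_1 = 1`, `1 < p`; derived here).
[cite: Matsumura1987, §27 (pp. 207–209)] -/
theorem substC_X_of_apply_apply_eq_zero (hu : ∀ n < p, ((n ! : ℕ) : k) * u n = 1) (hp : 1 < p) {i : ι}
    (h2 : D (D (MvPolynomial.X i)) = 0) (hq : q i = 0) :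
    substC D p u q (MvPolynomial.X i) = C (MvPolynomial.X i) + X * C (D (MvPolynomial.X i)) := by
  ext n
  rw [Polynomial.X_mul, Polynomial.coeff_add, Polynomial.coeff_C_mul, Polynomial.coeff_C, Polynomial.coeff_X]
  rcases Nat.lt_trichotomy n 1 with h0 | rfl | h2'
  · obtain rfl : n = 0 := by omega
    rw [coeff_substC_X_zero D p u q hu (by omega), if_pos rfl, if_neg one_ne_zero, mul_zero, add_zero]
  · rw [coeff_substC_X_one D p u q hu hp, if_neg one_ne_zero, if_pos rfl, mul_one, zero_add]
  · rw [if_neg (show n ≠ 0 by omega), if_neg (show 1 ≠ n by omega), mul_zero, add_zero, coeff_substC_X, hq, ite_self,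
      add_zero, iterate_X_eq_zero_of_two_le D h2 (by omega), smul_zero, ite_self]

/-- **`Φ(T)(ε_i) = ε_i + T·𝔇 ε_i + T^p·q_i`** when `𝔇(𝔇 ε_i) = 0` (`u_0 = u_1 = 1`, `1 < p`; derived here): the general slot formula
of case (H′). [cite: Matsumura1987, §27 (pp. 207–209)] -/
theorem substC_X_eq_of_apply_apply_eq_zero (hu : ∀ n < p, ((n ! : ℕ) : k) * u n = 1) (hp : 1 < p) {i : ι}
    (h2 : D (D (MvPolynomial.X i)) = 0) :
    substC D p u q (MvPolynomial.X i) = C (MvPolynomial.X i) + X * C (D (MvPolynomial.X i)) + X ^ p * C (q i) := by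
  ext n
  rw [Polynomial.X_mul, Polynomial.X_pow_mul, Polynomial.coeff_add, Polynomial.coeff_add, Polynomial.coeff_C,
    Polynomial.coeff_C_mul, Polynomial.coeff_X, Polynomial.coeff_C_mul_X_pow, coeff_substC_X]
  congr 1
  rcases Nat.lt_trichotomy n 1 with h0 | rfl | h2'
  · obtain rfl : n = 0 := by omega
    rw [if_pos (by omega), if_pos rfl, if_neg one_ne_zero, mul_zero, add_zero, Function.iterate_zero_apply,
      show u 0 = 1 by simpa using hu 0 (by omega), one_smul]
  · rw [if_pos hp, if_neg one_ne_zero, if_pos rfl, mul_one, zero_add, Function.iterate_one,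
      show u 1 = 1 by simpa using hu 1 hp, one_smul]
  · rw [if_neg (show n ≠ 0 by omega), if_neg (show 1 ≠ n by omega), mul_zero, add_zero,
      iterate_X_eq_zero_of_two_le D h2 (by omega), smul_zero, ite_self]

/-- **`Φ(T)(ε_i) = ε_i + T^p·q_i`** when `𝔇 ε_i = 0` (`u_0 = 1`, `0 < p`; derived here). [cite: Matsumura1987, §27 (pp. 207–209)] -/
theorem substC_X_of_apply_eq_zero (hu : ∀ n < p, ((n ! : ℕ) : k) * u n = 1) (hp : 0 < p) {i : ι} (hD : D (MvPolynomial.X i) = 0) :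
    substC D p u q (MvPolynomial.X i) = C (MvPolynomial.X i) + X ^ p * C (q i) := by
  ext n
  rw [Polynomial.X_pow_mul, Polynomial.coeff_add, Polynomial.coeff_C, Polynomial.coeff_C_mul_X_pow, coeff_substC_X]
  congr 1
  rcases Nat.eq_zero_or_pos n with rfl | hn
  · rw [if_pos hp, if_pos rfl, Function.iterate_zero_apply, show u 0 = 1 by simpa using hu 0 hp, one_smul]
  · obtain ⟨m, rfl⟩ := Nat.exists_eq_add_of_le' hn
    rw [if_neg (Nat.succ_ne_zero m), Function.iterate_succ_apply, hD, Function.iterate_fixed (map_zero D) m, smul_zero, ite_self]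

/-- **`Φ(T) = (T ↦ T^p) ∘ PolyShift.polyShift q`** when `𝔇 = 0` on the slots: a PURE-TAIL flow is the line of rigid translations
`ε ↦ ε + T̃·q` read at `T̃ = T^p` (derived here). [cite: Lang2002, Ch. IV §1] -/
theorem substC_eq_expand_comp_polyShift (hu : ∀ n < p, ((n ! : ℕ) : k) * u n = 1) (hp : 0 < p)
    (hD : ∀ i, D (MvPolynomial.X i) = 0) :
    substC D p u q = ((Polynomial.expand (MvPolynomial ι k) p).restrictScalars k).comp (PolyShift.polyShift q) :=
  MvPolynomial.algHom_ext fun i => by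
    rw [AlgHom.comp_apply, AlgHom.restrictScalars_apply, PolyShift.polyShift_X, map_add, map_mul, Polynomial.expand_C,
      Polynomial.expand_X, Polynomial.expand_C, substC_X_of_apply_eq_zero D p u q hu hp (hD i)]

/-- Hence `h(Φ(T)ε) = h` for a pure-tail flow means `polyShift q h = h` (`T ↦ T^p` is injective; derived here).
[cite: Lang2002, Ch. IV §1] -/
theorem polyShift_eq_C_of_substC_eq_C (hu : ∀ n < p, ((n ! : ℕ) : k) * u n = 1) (hp : 0 < p) (hD : ∀ i, D (MvPolynomial.X i) = 0)
    {F : MvPolynomial ι k} (hF : substC D p u q F = C F) : PolyShift.polyShift q F = C F := by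
  rw [substC_eq_expand_comp_polyShift D p u q hu hp hD, AlgHom.comp_apply, AlgHom.restrictScalars_apply] at hF
  exact Polynomial.expand_injective hp (by rwa [Polynomial.expand_C])

end TailFree

/-! ## The `Option`-world of the graded extraction (mixed data) -/

section MixedPrelim

variable {k : Type*} [CommRing k] {ι : Type*}

/-- The LIGHT weight `ω = w·[w < p]` (light slots keep their weight, heavy and `V` slots weigh `0`; ours, bookkeeping).
[cite: AbramovichTemkinWlodarczyk2024, §5.1 (p. 1575)] -/
def lightWt (p : ℕ) (w : ι → ℚ) : ι → ℚ := fun i => if w i < p then w i else 0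

/-- Bookkeeping. [cite: AbramovichTemkinWlodarczyk2024, §5.1 (p. 1575)] -/
theorem lightWt_of_lt {p : ℕ} {w : ι → ℚ} {i : ι} (h : w i < p) : lightWt p w i = w i := if_pos h

/-- Bookkeeping. [cite: AbramovichTemkinWlodarczyk2024, §5.1 (p. 1575)] -/
theorem lightWt_of_not_lt {p : ℕ} {w : ι → ℚ} {i : ι} (h : ¬ w i < p) : lightWt p w i = 0 := if_neg h

/-- Bookkeeping: positive light weights make `ω ≥ 0`. [cite: AbramovichTemkinWlodarczyk2024, §5.1 (p. 1575)] -/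
theorem lightWt_nonneg {p : ℕ} {w : ι → ℚ} (hw : ∀ i, w i < p → 0 < w i) (i : ι) : 0 ≤ lightWt p w i := by
  by_cases h : w i < p
  · rw [lightWt_of_lt h]; exact (hw i h).le
  · rw [lightWt_of_not_lt h]

/-- Bookkeeping: only light slots have positive `ω`. [cite: AbramovichTemkinWlodarczyk2024, §5.1 (p. 1575)] -/
theorem lt_of_lightWt_pos {p : ℕ} {w : ι → ℚ} {i : ι} (h : 0 < lightWt p w i) : w i < p := by
  by_contra hi
  rw [lightWt_of_not_lt hi] at h
  exact lt_irrefl _ h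

/-- The weight of the `Option`-world: the parameter slot `none` (`= T`) weighs `−κ` (ours, bookkeeping). [cite: Lang2002, Ch. IV §1] -/
def optWt (κ : ℚ) (p : ℕ) (w : ι → ℚ) : Option ι → ℚ := fun o => o.elim (-κ) (lightWt p w)

/-- The FULL family `ε_j ↦ ε_j + T·A_j + T^p·q_j` in `MvPolynomial (Option ι) k` (`T = X none`; ours). [cite: Lang2002, Ch. IV §1] -/
noncomputable def fullFamily (p : ℕ) (A q : ι → MvPolynomial ι k) : ι → MvPolynomial (Option ι) k := fun j =>
  MvPolynomial.X (some j) + MvPolynomial.X none * MvPolynomial.rename some (A j)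
    + MvPolynomial.X none ^ p * MvPolynomial.rename some (q j)

/-- The SURVIVOR family at level `κ`: keep `T·A_j` only where `w_j − θ = κ` and `T^p·q_j` only where `w_j − pθ = pκ` (ours).
[cite: Lang2002, Ch. IV §1] -/
noncomputable def survFamily (κ : ℚ) (p : ℕ) (w : ι → ℚ) (θ : ℚ) (A q : ι → MvPolynomial ι k) : ι → MvPolynomial (Option ι) k :=
  fun j => MvPolynomial.X (some j) + (if w j - θ = κ then MvPolynomial.X none * MvPolynomial.rename some (A j) else 0)
    + (if w j - p • θ = p * κ then MvPolynomial.X none ^ p * MvPolynomial.rename some (q j) else 0)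

/-- The REST: the non-surviving terms (ours). [cite: Lang2002, Ch. IV §1] -/
noncomputable def restFamily (κ : ℚ) (p : ℕ) (w : ι → ℚ) (θ : ℚ) (A q : ι → MvPolynomial ι k) : ι → MvPolynomial (Option ι) k :=
  fun j => (if w j - θ = κ then 0 else MvPolynomial.X none * MvPolynomial.rename some (A j))
    + (if w j - p • θ = p * κ then 0 else MvPolynomial.X none ^ p * MvPolynomial.rename some (q j))

/-- `survivors + rest = full family` (bookkeeping). [cite: Lang2002, Ch. IV §1] -/
theorem surv_add_rest (κ : ℚ) (p : ℕ) (w : ι → ℚ) (θ : ℚ) (A q : ι → MvPolynomial ι k) :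
    (fun j => survFamily κ p w θ A q j + restFamily κ p w θ A q j) = fullFamily p A q := by
  funext j
  simp only [survFamily, restFamily, fullFamily]
  split_ifs <;> ring

/-- Transport of a general substitution through `optionEquivLeft` (bookkeeping about Mathlib's `optionEquivLeft`).
[cite: Lang2002, Ch. IV §1] -/
theorem optionEquivLeft_aeval_apply (f : ι → MvPolynomial (Option ι) k) (P : MvPolynomial ι k) :
    MvPolynomial.optionEquivLeft k ι (MvPolynomial.aeval f P)
      = MvPolynomial.aeval (fun j => MvPolynomial.optionEquivLeft k ι (f j)) P := by
  induction P using MvPolynomial.induction_on with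
  | C r =>
    rw [MvPolynomial.aeval_C, MvPolynomial.aeval_C, MvPolynomial.algebraMap_eq, MvPolynomial.optionEquivLeft_C,
      Polynomial.algebraMap_apply, MvPolynomial.algebraMap_eq]
  | add p q hp hq => rw [map_add, map_add, hp, hq, map_add]
  | mul_X p j hp => rw [map_mul, map_mul, hp, MvPolynomial.aeval_X, map_mul, MvPolynomial.aeval_X]

/-- `optionEquivLeft` of the full family is the slot formula `C ε_j + T·C A_j + T^p·C q_j` (bookkeeping). [cite: Lang2002, Ch. IV §1] -/
theorem optionEquivLeft_fullFamily (p : ℕ) (A q : ι → MvPolynomial ι k) (j : ι) :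
    MvPolynomial.optionEquivLeft k ι (fullFamily p A q j) = C (MvPolynomial.X j) + X * C (A j) + X ^ p * C (q j) := by
  simp only [fullFamily, map_add, map_mul, map_pow, MvPolynomial.optionEquivLeft_X_some, MvPolynomial.optionEquivLeft_X_none,
    VertexStep.optionEquivLeft_rename_some]

/-- `ε_j ↦ C ε_j + T^p·C v_j` is the line `polyShift v` read at `T^p` (bookkeeping). [cite: Lang2002, Ch. IV §1] -/
theorem aeval_C_add_X_pow_mul_C (p : ℕ) (v : ι → MvPolynomial ι k) :
    MvPolynomial.aeval (fun j => C (MvPolynomial.X j) + X ^ p * C (v j))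
      = ((Polynomial.expand (MvPolynomial ι k) p).restrictScalars k).comp (PolyShift.polyShift v) :=
  MvPolynomial.algHom_ext fun i => by
    rw [MvPolynomial.aeval_X, AlgHom.comp_apply, AlgHom.restrictScalars_apply, PolyShift.polyShift_X, map_add, map_mul,
      Polynomial.expand_C, Polynomial.expand_X, Polynomial.expand_C]

end MixedPrelim

/-! ## The base case (H′) via LEMMA L: the tail-free and the pure-tail forms -/

section HeavyBase

variable {k : Type*} [Field k] {ι : Type*} {p : ℕ} {u : ℕ → k} {w : ι → ℚ} {θ : ℚ}
  {h : MvPolynomial ι k} {D : Derivation k (MvPolynomial ι k) (MvPolynomial ι k)} {q : ι → MvPolynomial ι k}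

namespace IsTailedLightFlow

/-- If `𝔇` kills the light slots then `𝔇² = 0` on generators: the data involve light variables only (derived here; chain rule).
[cite: Matsumura1987, §25] -/
theorem apply_apply_X_eq_zero [Fintype ι] (F : IsTailedLightFlow p u w θ h D q) (hDℓ : ∀ i, w i < p → D (MvPolynomial.X i) = 0)
    (i : ι) : D (D (MvPolynomial.X i)) = 0 := by
  rw [derivation_apply_eq_sum_pderiv_mul D (D (MvPolynomial.X i))]
  refine Finset.sum_eq_zero fun j _ => ?_
  by_cases hj : w j < p
  · rw [hDℓ j hj, mul_zero]
  · rw [MvPolynomial.pderiv_eq_zero_of_notMem_vars (fun hm => hj (F.vars_D i j hm).1), zero_mul]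

/-- **`Φ(T) = PolyShift.polyShift (𝔇 ∘ ε)`**: a tail-free tailed light flow moving no light slot is a LINE OF RIGID TRANSLATIONS
`ε ↦ ε + T·𝔇ε` (derived here). [cite: Lang2002, Ch. IV §1] -/
theorem substC_eq_polyShift [Fintype ι] (F : IsTailedLightFlow p u w θ h D q) (hu : ∀ n < p, ((n ! : ℕ) : k) * u n = 1)
    (hp : 1 < p) (hDℓ : ∀ i, w i < p → D (MvPolynomial.X i) = 0) (hq : ∀ i, q i = 0) :
    substC D p u q = PolyShift.polyShift fun j => D (MvPolynomial.X j) :=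
  MvPolynomial.algHom_ext fun i => by
    rw [PolyShift.polyShift_X, substC_X_of_apply_apply_eq_zero D p u q hu hp (F.apply_apply_X_eq_zero hDℓ i) (hq i)]

/-- The data are homogeneous for the LIGHT weight `ω = w·[w < p]` as well (derived here): they involve light variables only.
[cite: AbramovichTemkinWlodarczyk2024, Thm. 5.3.1 (2)-(3) (p. 1578)] -/
theorem isWeightedHomogeneous_light (F : IsTailedLightFlow p u w θ h D q) (j : ι) :
    MvPolynomial.IsWeightedHomogeneous (fun i => if w i < p then w i else 0) (D (MvPolynomial.X j)) (w j - θ) :=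
  RZReduction.isWeightedHomogeneous_of_eqOn_vars (fun i hi => if_pos (F.vars_D j i hi).1) (F.wt_D j)

/-- **(H′), tail-free form, via LEMMA L** (derived here): there is NO tailed light flow with `q = 0` whose derivation kills every light
slot, on a menu with positive light weights whose faces `h|_{≥ w_x}` are class-pinned (`InvariantDirection.ClassPinned`) at the moved
heavy slots `x`.  [cite: Lang2002, Ch. IV §1, Ch. XIII §4] [cite: AbramovichTemkinWlodarczyk2024, §5.1 (p. 1575), Thm. 5.3.1] -/
theorem false_of_tailFree [Fintype ι] [DecidableEq ι] (F : IsTailedLightFlow p u w θ h D q)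
    (hu : ∀ n < p, ((n ! : ℕ) : k) * u n = 1) (hp : 1 < p) (hw : ∀ i, w i < p → 0 < w i)
    (hDℓ : ∀ i, w i < p → D (MvPolynomial.X i) = 0) (hq : ∀ i, q i = 0)
    (hPin : ∀ j, D (MvPolynomial.X j) ≠ 0 →
      InvariantDirection.ClassPinned (Finset.univ.filter fun i => w i = w j) (killLight (fun i => w j ≤ w i) h) j) :
    False := by
  have hlt : ∀ i, 0 < (if w i < p then w i else 0) → w i < p := fun i hi => by
    by_contra hip
    rw [if_neg hip] at hi
    exact lt_irrefl _ hi
  have key := LemmaL.eq_zero_of_classPinned w (fun i => if w i < p then w i else 0)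
    (fun i => by
      split_ifs with hi
      · exact (hw i hi).le
      · exact le_rfl)
    (fun j => D (MvPolynomial.X j)) (fun j => w j - θ)
    (fun j i hi => by
      rw [if_pos (F.vars_D j i hi).1]
      exact hw i (F.vars_D j i hi).1)
    (fun j hj => hDℓ j (hlt j hj)) F.isWeightedHomogeneous_light (fun _ _ _ _ e => sub_left_inj.mp e)
    (fun j i hj hi => by
      have hip := hlt i hi
      have hjp : ¬ w j < p := fun hjp => hj (hDℓ j hjp)
      exact lt_of_lt_of_le hip (not_lt.mp hjp))
    hPin (by rw [← F.substC_eq_polyShift hu hp hDℓ hq]; exact F.fix)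
  rcases F.ne_zero with ⟨i, hi⟩ | ⟨i, hi⟩
  · exact hi (by simpa using congrFun key i)
  · exact hi (hq i)

/-- The tails are homogeneous for the LIGHT weight `ω = w·[w < p]` as well (derived here): they involve light variables only.
[cite: AbramovichTemkinWlodarczyk2024, Thm. 5.3.1 (2)-(3) (p. 1578)] -/
theorem isWeightedHomogeneous_light_q (F : IsTailedLightFlow p u w θ h D q) (j : ι) :
    MvPolynomial.IsWeightedHomogeneous (fun i => if w i < p then w i else 0) (q j) (w j - p • θ) :=
  RZReduction.isWeightedHomogeneous_of_eqOn_vars (fun i hi => if_pos (F.vars_q j i hi)) (F.wt_q j)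

/-- **(H′), pure-tail form, via LEMMA L** (derived here): there is NO tailed light flow whose derivation kills EVERY slot
(`Φ(T) = ε + T^p q`), on a menu with positive light weights whose faces `h|_{≥ w_x}` are class-pinned at the tailed heavy slots `x` —
LEMMA L applied to the line `ε ↦ ε + T̃·q`, `T̃ = T^p`.
[cite: Lang2002, Ch. IV §1, Ch. XIII §4] [cite: AbramovichTemkinWlodarczyk2024, §5.1 (p. 1575), Thm. 5.3.1] -/
theorem false_of_pureTail [Fintype ι] [DecidableEq ι] (F : IsTailedLightFlow p u w θ h D q)
    (hu : ∀ n < p, ((n ! : ℕ) : k) * u n = 1) (hp : 0 < p) (hw : ∀ i, w i < p → 0 < w i)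
    (hD : ∀ i, D (MvPolynomial.X i) = 0)
    (hPin : ∀ j, q j ≠ 0 →
      InvariantDirection.ClassPinned (Finset.univ.filter fun i => w i = w j) (killLight (fun i => w j ≤ w i) h) j) :
    False := by
  have hlt : ∀ i, 0 < (if w i < p then w i else 0) → w i < p := fun i hi => by
    by_contra hip
    rw [if_neg hip] at hi
    exact lt_irrefl _ hi
  have key := LemmaL.eq_zero_of_classPinned w (fun i => if w i < p then w i else 0)
    (fun i => by
      split_ifs with hi
      · exact (hw i hi).le
      · exact le_rfl)
    q (fun j => w j - p • θ)
    (fun j i hi => by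
      rw [if_pos (F.vars_q j i hi)]
      exact hw i (F.vars_q j i hi))
    (fun j hj => F.q_eq_zero_of_light (hlt j hj)) F.isWeightedHomogeneous_light_q (fun _ _ _ _ e => sub_left_inj.mp e)
    (fun j i hj hi => by
      have hip := hlt i hi
      have hjp : ¬ w j < p := fun hjp => hj (F.q_eq_zero_of_light hjp)
      exact lt_of_lt_of_le hip (not_lt.mp hjp))
    hPin (polyShift_eq_C_of_substC_eq_C D p u q hu hp hD F.fix)
  rcases F.ne_zero with ⟨i, hi⟩ | ⟨i, hi⟩
  · exact hi (hD i)
  · exact hi (congrFun key i)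

/-! ## The general base case (H′): mixed data `T·A_x + T^p·q_x` -/

/-- The hypothesis `h(Φ(T)ε) = h` read in the `Option`-world: `h(fullFamily) = h` (derived here). [cite: Lang2002, Ch. IV §1] -/
theorem aeval_fullFamily_eq [Fintype ι] (F : IsTailedLightFlow p u w θ h D q) (hu : ∀ n < p, ((n ! : ℕ) : k) * u n = 1)
    (hp : 1 < p) (hDℓ : ∀ i, w i < p → D (MvPolynomial.X i) = 0) :
    MvPolynomial.aeval (fullFamily p (fun j => D (MvPolynomial.X j)) q) h = MvPolynomial.rename some h := by
  apply (MvPolynomial.optionEquivLeft k ι).injective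
  rw [optionEquivLeft_aeval_apply, VertexStep.optionEquivLeft_rename_some, ← F.fix]
  simp only [optionEquivLeft_fullFamily]
  refine DFunLike.congr_fun (MvPolynomial.algHom_ext (fun i => ?_) : MvPolynomial.aeval _ = substC D p u q) h
  rw [MvPolynomial.aeval_X, substC_X_eq_of_apply_apply_eq_zero D p u q hu hp (F.apply_apply_X_eq_zero hDℓ i)]

/-- **Graded extraction of the CORE identity** (derived here; L5 with `wt T = −κ`, `κ ≤` every `w_x − θ` (`A_x ≠ 0`) and `pκ ≤` every
`w_x − pθ` (`q_x ≠ 0`)): the weight-`0` part `h̄` of `h` (`= h|_{ℓ=0}` on the face) satisfies `h̄(survFamily κ) = h̄` — only the terms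
`T·A_x` with `w_x − θ = κ` and `T^p·q_x` with `w_x − pθ = pκ` survive. [cite: Lang2002, Ch. IV §1] [cite: Matsumura1987, §27 (p. 207)] -/
theorem aeval_survFamily_core [Fintype ι] [DecidableEq ι] (F : IsTailedLightFlow p u w θ h D q)
    (hu : ∀ n < p, ((n ! : ℕ) : k) * u n = 1) (hp : 1 < p) (hw : ∀ i, w i < p → 0 < w i)
    (hDℓ : ∀ i, w i < p → D (MvPolynomial.X i) = 0) {κ : ℚ} (hκA : ∀ j, D (MvPolynomial.X j) ≠ 0 → κ ≤ w j - θ)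
    (hκq : ∀ j, q j ≠ 0 → p * κ ≤ w j - p • θ) :
    MvPolynomial.aeval (survFamily κ p w θ (fun j => D (MvPolynomial.X j)) q)
        (MvPolynomial.weightedHomogeneousComponent (lightWt p w) 0 h)
      = MvPolynomial.rename some (MvPolynomial.weightedHomogeneousComponent (lightWt p w) 0 h) := by
  have hcomp : optWt κ p w ∘ some = lightWt p w := rfl
  have hA0 : ∀ j, D (MvPolynomial.X j) ≠ 0 → lightWt p w j = 0 := fun j hj => lightWt_of_not_lt fun hjp => hj (hDℓ j hjp)
  have hq0 : ∀ j, q j ≠ 0 → lightWt p w j = 0 := fun j hj => lightWt_of_not_lt fun hjp => hj (F.q_eq_zero_of_light hjp)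
  have hXn : MvPolynomial.IsWeightedHomogeneous (optWt κ p w) (MvPolynomial.X none : MvPolynomial (Option ι) k) (-κ) :=
    MvPolynomial.isWeightedHomogeneous_X k _ none
  have hAh : ∀ j, MvPolynomial.IsWeightedHomogeneous (optWt κ p w)
      (MvPolynomial.X none * MvPolynomial.rename some (D (MvPolynomial.X j))) (-κ + (w j - θ)) := fun j =>
    hXn.mul (LemmaL.isWeightedHomogeneous_rename_some (K := k) hcomp (F.isWeightedHomogeneous_light j))
  have hqh : ∀ j, MvPolynomial.IsWeightedHomogeneous (optWt κ p w)
      (MvPolynomial.X none ^ p * MvPolynomial.rename some (q j)) (p • (-κ) + (w j - p • θ)) := fun j =>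
    (hXn.pow p).mul (LemmaL.isWeightedHomogeneous_rename_some (K := k) hcomp (F.isWeightedHomogeneous_light_q j))
  -- the survivor family is homogeneous of the slot weight
  have ha : ∀ j, MvPolynomial.IsWeightedHomogeneous (optWt κ p w) (survFamily κ p w θ (fun j => D (MvPolynomial.X j)) q j)
      (lightWt p w j) := by
    intro j
    refine ((MvPolynomial.isWeightedHomogeneous_X k (optWt κ p w) (some j)).add ?_).add ?_
    · change MvPolynomial.IsWeightedHomogeneous (optWt κ p w)
        (if w j - θ = κ then MvPolynomial.X none * MvPolynomial.rename some (D (MvPolynomial.X j)) else 0) (lightWt p w j)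
      split_ifs with hc
      · by_cases hA : D (MvPolynomial.X j) = 0
        · rw [hA, map_zero, mul_zero]; exact MvPolynomial.isWeightedHomogeneous_zero k _ _
        · have e : -κ + (w j - θ) = lightWt p w j := by rw [hc, hA0 j hA]; ring
          rw [← e]; exact hAh j
      · exact MvPolynomial.isWeightedHomogeneous_zero k _ _
    · change MvPolynomial.IsWeightedHomogeneous (optWt κ p w)
        (if w j - p • θ = p * κ then MvPolynomial.X none ^ p * MvPolynomial.rename some (q j) else 0) (lightWt p w j)
      split_ifs with hc
      · by_cases hqj : q j = 0
        · rw [hqj, map_zero, mul_zero]; exact MvPolynomial.isWeightedHomogeneous_zero k _ _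
        · have e : p • (-κ) + (w j - p • θ) = lightWt p w j := by rw [hc, hq0 j hqj, nsmul_eq_mul]; ring
          rw [← e]; exact hqh j
      · exact MvPolynomial.isWeightedHomogeneous_zero k _ _
  -- the rest weighs strictly more
  have hb : ∀ j, LeadingForm.WtGT (optWt κ p w) (lightWt p w j) (restFamily κ p w θ (fun j => D (MvPolynomial.X j)) q j) := by
    intro j
    refine LeadingForm.WtGT.add ?_ ?_
    · change LeadingForm.WtGT (optWt κ p w) (lightWt p w j)
        (if w j - θ = κ then 0 else MvPolynomial.X none * MvPolynomial.rename some (D (MvPolynomial.X j)))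
      split_ifs with hc
      · exact LeadingForm.wtGT_zero _
      · by_cases hA : D (MvPolynomial.X j) = 0
        · rw [hA, map_zero, mul_zero]; exact LeadingForm.wtGT_zero _
        · refine (LeadingForm.wtGE_of_isWeightedHomogeneous (hAh j)).wtGT_of_lt ?_
          rw [hA0 j hA]
          rcases (hκA j hA).lt_or_eq with hlt | heq
          · linarith
          · exact absurd heq.symm hc
    · change LeadingForm.WtGT (optWt κ p w) (lightWt p w j)
        (if w j - p • θ = p * κ then 0 else MvPolynomial.X none ^ p * MvPolynomial.rename some (q j))
      split_ifs with hc
      · exact LeadingForm.wtGT_zero _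
      · by_cases hqj : q j = 0
        · rw [hqj, map_zero, mul_zero]; exact LeadingForm.wtGT_zero _
        · refine (LeadingForm.wtGE_of_isWeightedHomogeneous (hqh j)).wtGT_of_lt ?_
          rw [hq0 j hqj, nsmul_eq_mul]
          rcases (hκq j hqj).lt_or_eq with hlt | heq
          · linarith
          · exact absurd heq.symm hc
  have hG : LeadingForm.WtGE (lightWt p w) 0 h := LemmaL.wtGE_zero_of_nonneg (lightWt_nonneg hw) h
  have key := LeadingForm.weightedHomogeneousComponent_aeval_of_wtGE (wt := optWt κ p w) (w := lightWt p w)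
    (a := survFamily κ p w θ (fun j => D (MvPolynomial.X j)) q) (b := restFamily κ p w θ (fun j => D (MvPolynomial.X j)) q)
    (n := 0) ha hb hG
  rw [surv_add_rest, F.aeval_fullFamily_eq hu hp hDℓ, LemmaL.weightedHomogeneousComponent_rename_some (K := k) hcomp] at key
  exact key.symm

/-- **A-type survivors only ⇒ the core is fixed by the LINE `ε ↦ ε + T·A^{surv}`** (derived here). [cite: Lang2002, Ch. IV §1] -/
theorem polyShift_core_of_derivSurvivors [Fintype ι] [DecidableEq ι] (F : IsTailedLightFlow p u w θ h D q)
    (hu : ∀ n < p, ((n ! : ℕ) : k) * u n = 1) (hp : 1 < p) (hw : ∀ i, w i < p → 0 < w i)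
    (hDℓ : ∀ i, w i < p → D (MvPolynomial.X i) = 0) {κ : ℚ} (hκA : ∀ j, D (MvPolynomial.X j) ≠ 0 → κ ≤ w j - θ)
    (hκq : ∀ j, q j ≠ 0 → p * κ ≤ w j - p • θ) (hnoq : ∀ j, w j - p • θ = p * κ → q j = 0) :
    PolyShift.polyShift (fun j => if w j - θ = κ then D (MvPolynomial.X j) else 0)
        (MvPolynomial.weightedHomogeneousComponent (lightWt p w) 0 h)
      = C (MvPolynomial.weightedHomogeneousComponent (lightWt p w) 0 h) := by
  have hfam : survFamily κ p w θ (fun j => D (MvPolynomial.X j)) q = fun j => MvPolynomial.X (some j)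
      + MvPolynomial.X none * MvPolynomial.rename some (if w j - θ = κ then D (MvPolynomial.X j) else 0) := by
    funext j
    simp only [survFamily]
    by_cases hc' : w j - p • θ = p * κ
    · rw [if_pos hc', hnoq j hc', map_zero, mul_zero, add_zero]
      split_ifs <;> simp
    · rw [if_neg hc', add_zero]
      split_ifs <;> simp
  have key := F.aeval_survFamily_core hu hp hw hDℓ hκA hκq
  rw [hfam] at key
  have k2 := congrArg (MvPolynomial.optionEquivLeft k ι) key
  rw [VertexStep.optionEquivLeft_aeval, VertexStep.optionEquivLeft_rename_some] at k2
  exact k2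

/-- **Tail-type survivors only ⇒ the core is fixed by the LINE `ε ↦ ε + T̃·q^{surv}`**, `T̃ = T^p` (derived here; `T ↦ T^p` is
injective). [cite: Lang2002, Ch. IV §1] -/
theorem polyShift_core_of_tailSurvivors [Fintype ι] [DecidableEq ι] (F : IsTailedLightFlow p u w θ h D q)
    (hu : ∀ n < p, ((n ! : ℕ) : k) * u n = 1) (hp : 1 < p) (hw : ∀ i, w i < p → 0 < w i)
    (hDℓ : ∀ i, w i < p → D (MvPolynomial.X i) = 0) {κ : ℚ} (hκA : ∀ j, D (MvPolynomial.X j) ≠ 0 → κ ≤ w j - θ)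
    (hκq : ∀ j, q j ≠ 0 → p * κ ≤ w j - p • θ) (hnoA : ∀ j, w j - θ = κ → D (MvPolynomial.X j) = 0) :
    PolyShift.polyShift (fun j => if w j - p • θ = p * κ then q j else 0)
        (MvPolynomial.weightedHomogeneousComponent (lightWt p w) 0 h)
      = C (MvPolynomial.weightedHomogeneousComponent (lightWt p w) 0 h) := by
  have hfam : survFamily κ p w θ (fun j => D (MvPolynomial.X j)) q = fun j => MvPolynomial.X (some j)
      + MvPolynomial.X none ^ p * MvPolynomial.rename some (if w j - p • θ = p * κ then q j else 0) := by
    funext j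
    simp only [survFamily]
    by_cases hc' : w j - θ = κ
    · rw [if_pos hc', hnoA j hc', map_zero, mul_zero, add_zero]
      split_ifs <;> simp
    · rw [if_neg hc', add_zero]
      split_ifs <;> simp
  have key := F.aeval_survFamily_core hu hp hw hDℓ hκA hκq
  rw [hfam] at key
  have k2 := congrArg (MvPolynomial.optionEquivLeft k ι) key
  rw [optionEquivLeft_aeval_apply, VertexStep.optionEquivLeft_rename_some] at k2
  simp only [map_add, map_mul, map_pow, MvPolynomial.optionEquivLeft_X_some, MvPolynomial.optionEquivLeft_X_none,
    VertexStep.optionEquivLeft_rename_some] at k2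
  rw [aeval_C_add_X_pow_mul_C, AlgHom.comp_apply, AlgHom.restrictScalars_apply] at k2
  exact Polynomial.expand_injective (zero_lt_one.trans hp) (by rwa [Polynomial.expand_C])

/-- **A-type and tail-type survivors never coexist** (derived here; the engine's `p·w(C_A) ≥ p² > p + 1`): a survivor of `A`-type
weighs `θ + κ ≥ p`, one of tail-type would weigh `p(θ + κ) ≥ p²`, but tailed slots weigh `≤ p + 1`.
[cite: AbramovichTemkinWlodarczyk2024, §5.1 (p. 1575)] -/
theorem not_both_survivors (F : IsTailedLightFlow p u w θ h D q) (hp : 1 < p) (hDℓ : ∀ i, w i < p → D (MvPolynomial.X i) = 0)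
    {κ : ℚ} {x y : ι} (hx : D (MvPolynomial.X x) ≠ 0) (hxκ : w x - θ = κ) (hy : q y ≠ 0) (hyκ : w y - p • θ = p * κ) :
    False := by
  have hxp : (p : ℚ) ≤ w x := not_lt.mp fun hlt => hx (hDℓ x hlt)
  have hyp : w y ≤ (p : ℚ) + 1 := not_lt.mp fun hlt => hy (F.q_eq_zero y (Or.inr hlt))
  have hp2 : (2 : ℚ) ≤ p := by exact_mod_cast hp
  rw [nsmul_eq_mul] at hyκ
  have hp0 : (0 : ℚ) ≤ p := by linarith
  have hwy : w y = p * w x := by linear_combination hyκ - (p : ℚ) * hxκ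
  nlinarith [mul_le_mul_of_nonneg_left hxp hp0, mul_le_mul_of_nonneg_left hp2 hp0]

/-- **(H′) in general, via the graded extraction + LEMMA L at one weight** (derived here): there is NO tailed light flow whose
derivation kills every light slot — data `Φ(T)(x) = x + T·A_x(ℓ) + T^p·q_x(ℓ)` on the heavy slots, MIXED allowed — on a menu with
positive light weights whose CORE `h̿ = h|_{ℓ=0}` is class-pinned (`InvariantDirection.ClassPinned`) at every moved or tailed heavy slot.
Proof: `κ :=` the least of the `w_x − θ` (`A_x ≠ 0`) and `(w_x − pθ)/p` (`q_x ≠ 0`); the survivors at level `κ` are of ONE type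
(`not_both_survivors`); the core identity is a line of rigid translations in `T` (resp. `T̃ = T^p`), and
`LemmaL.component_eq_zero_of_classPinned` at weight `κ` (resp. `pκ`) kills the surviving block — a contradiction.
[cite: Lang2002, Ch. IV §1, Ch. XIII §4] [cite: Matsumura1987, §27 (pp. 207–209)]
[cite: AbramovichTemkinWlodarczyk2024, §5.1 (p. 1575), Thm. 5.3.1] -/
theorem false_of_light_fixed [Fintype ι] [DecidableEq ι] (F : IsTailedLightFlow p u w θ h D q)
    (hu : ∀ n < p, ((n ! : ℕ) : k) * u n = 1) (hp : 1 < p) (hw : ∀ i, w i < p → 0 < w i)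
    (hDℓ : ∀ i, w i < p → D (MvPolynomial.X i) = 0)
    (hPinA : ∀ j, D (MvPolynomial.X j) ≠ 0 →
      InvariantDirection.ClassPinned (Finset.univ.filter fun i => w i = w j) (killLight (fun i => ¬ w i < p) h) j)
    (hPinq : ∀ j, q j ≠ 0 →
      InvariantDirection.ClassPinned (Finset.univ.filter fun i => w i = w j) (killLight (fun i => ¬ w i < p) h) j) :
    False := by
  classical
  -- the least level `κ`
  have hne : ((Finset.univ.filter fun j => D (MvPolynomial.X j) ≠ 0).image (fun j => w j - θ) ∪
      (Finset.univ.filter fun j => q j ≠ 0).image (fun j => (w j - p • θ) / p)).Nonempty := by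
    rcases F.ne_zero with ⟨i, hi⟩ | ⟨i, hi⟩
    · exact ⟨_, Finset.mem_union_left _ (Finset.mem_image_of_mem _ (Finset.mem_filter.mpr ⟨Finset.mem_univ _, hi⟩))⟩
    · exact ⟨_, Finset.mem_union_right _ (Finset.mem_image_of_mem _ (Finset.mem_filter.mpr ⟨Finset.mem_univ _, hi⟩))⟩
  obtain ⟨κ, hκmem, hκmin⟩ : ∃ κ, κ ∈ ((Finset.univ.filter fun j => D (MvPolynomial.X j) ≠ 0).image (fun j => w j - θ) ∪
      (Finset.univ.filter fun j => q j ≠ 0).image (fun j => (w j - p • θ) / p)) ∧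
      ∀ κ' ∈ ((Finset.univ.filter fun j => D (MvPolynomial.X j) ≠ 0).image (fun j => w j - θ) ∪
        (Finset.univ.filter fun j => q j ≠ 0).image (fun j => (w j - p • θ) / p)), κ ≤ κ' :=
    ⟨_, Finset.min'_mem _ hne, fun κ' hκ' => Finset.min'_le _ κ' hκ'⟩
  have hp0 : (0 : ℚ) < p := by exact_mod_cast (by omega : 0 < p)
  have hκA : ∀ j, D (MvPolynomial.X j) ≠ 0 → κ ≤ w j - θ := fun j hj =>
    hκmin _ (Finset.mem_union_left _ (Finset.mem_image_of_mem _ (Finset.mem_filter.mpr ⟨Finset.mem_univ _, hj⟩)))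
  have hκq : ∀ j, q j ≠ 0 → p * κ ≤ w j - p • θ := fun j hj => by
    have h1 : κ ≤ (w j - p • θ) / p :=
      hκmin _ (Finset.mem_union_right _ (Finset.mem_image_of_mem _ (Finset.mem_filter.mpr ⟨Finset.mem_univ _, hj⟩)))
    rw [mul_comm]
    exact (le_div_iff₀ hp0).mp h1
  have hHω : ∀ i, ¬ w i < p → lightWt p w i = 0 := fun i hi => lightWt_of_not_lt hi
  have hcore : killLight (fun i => ¬ w i < p) (MvPolynomial.weightedHomogeneousComponent (lightWt p w) 0 h)
      = killLight (fun i => ¬ w i < p) h :=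
    LemmaL.killLight_weightedHomogeneousComponent_zero (fun i => ¬ w i < p) (lightWt p w) hHω h
  rcases Finset.mem_union.mp hκmem with hκ | hκ
  · -- an `A`-type survivor `x`: no tail-type survivors
    obtain ⟨x, hx, hxκ⟩ := Finset.mem_image.mp hκ
    have hx' : D (MvPolynomial.X x) ≠ 0 := (Finset.mem_filter.mp hx).2
    have hnoq : ∀ j, w j - p • θ = p * κ → q j = 0 := fun j hj => by
      by_contra hqj
      exact F.not_both_survivors hp hDℓ hx' hxκ hqj hj
    have hident := F.polyShift_core_of_derivSurvivors hu hp hw hDℓ hκA hκq hnoq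
    have key := LemmaL.component_eq_zero_of_classPinned (lightWt p w) (lightWt_nonneg hw)
      (fun j => if w j - θ = κ then D (MvPolynomial.X j) else 0) κ
      (fun j i hi => by
        have hc : w j - θ = κ := by by_contra hc; rw [if_neg hc, MvPolynomial.vars_0] at hi; simp at hi
        rw [if_pos hc] at hi
        rw [lightWt_of_lt (F.vars_D j i hi).1]
        exact hw i (F.vars_D j i hi).1)
      (fun j hj => by rw [hDℓ j (lt_of_lightWt_pos hj), ite_self])
      (fun j => by
        split_ifs with hc
        · rw [← hc]; exact LeadingForm.wtGE_of_isWeightedHomogeneous (F.isWeightedHomogeneous_light j)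
        · exact LeadingForm.wtGE_zero _)
      hident (Finset.univ.filter fun i => w i = w x)
      (fun j hj => by
        have hc : w j - θ = κ := by by_contra hc; rw [if_neg hc, map_zero] at hj; exact hj rfl
        exact Finset.mem_filter.mpr ⟨Finset.mem_univ _, by linarith⟩)
      (fun i => ¬ w i < p) (fun j hj => by
        rw [(Finset.mem_filter.mp hj).2]
        exact fun hlt => hx' (hDℓ x hlt)) hHω
      (Finset.mem_filter.mpr ⟨Finset.mem_univ _, rfl⟩) (by rw [hcore]; exact hPinA x hx') x
    have hsame : MvPolynomial.weightedHomogeneousComponent (lightWt p w) κ (D (MvPolynomial.X x)) = D (MvPolynomial.X x) := by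
      rw [← hxκ]
      exact (F.isWeightedHomogeneous_light x).weightedHomogeneousComponent_same
    rw [if_pos hxκ, hsame] at key
    exact hx' key
  · -- a tail-type survivor `y`: no `A`-type survivors
    obtain ⟨y, hy, hyκ⟩ := Finset.mem_image.mp hκ
    have hy' : q y ≠ 0 := (Finset.mem_filter.mp hy).2
    have hyκ' : w y - p • θ = p * κ := by rw [← hyκ, mul_div_cancel₀ _ hp0.ne']
    have hnoA : ∀ j, w j - θ = κ → D (MvPolynomial.X j) = 0 := fun j hj => by
      by_contra hAj
      exact F.not_both_survivors hp hDℓ hAj hj hy' hyκ'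
    have hident := F.polyShift_core_of_tailSurvivors hu hp hw hDℓ hκA hκq hnoA
    have key := LemmaL.component_eq_zero_of_classPinned (lightWt p w) (lightWt_nonneg hw)
      (fun j => if w j - p • θ = p * κ then q j else 0) (p * κ)
      (fun j i hi => by
        have hc : w j - p • θ = p * κ := by by_contra hc; rw [if_neg hc, MvPolynomial.vars_0] at hi; simp at hi
        rw [if_pos hc] at hi
        rw [lightWt_of_lt (F.vars_q j i hi)]
        exact hw i (F.vars_q j i hi))
      (fun j hj => by rw [F.q_eq_zero_of_light (lt_of_lightWt_pos hj), ite_self])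
      (fun j => by
        split_ifs with hc
        · rw [← hc]; exact LeadingForm.wtGE_of_isWeightedHomogeneous (F.isWeightedHomogeneous_light_q j)
        · exact LeadingForm.wtGE_zero _)
      hident (Finset.univ.filter fun i => w i = w y)
      (fun j hj => by
        have hc : w j - p • θ = p * κ := by by_contra hc; rw [if_neg hc, map_zero] at hj; exact hj rfl
        exact Finset.mem_filter.mpr ⟨Finset.mem_univ _, by linarith⟩)
      (fun i => ¬ w i < p) (fun j hj => by
        rw [(Finset.mem_filter.mp hj).2]
        exact fun hlt => hy' (F.q_eq_zero_of_light hlt)) hHω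
      (Finset.mem_filter.mpr ⟨Finset.mem_univ _, rfl⟩) (by rw [hcore]; exact hPinq y hy') y
    have hsame : MvPolynomial.weightedHomogeneousComponent (lightWt p w) (p * κ) (q y) = q y := by
      rw [← hyκ']
      exact (F.isWeightedHomogeneous_light_q y).weightedHomogeneousComponent_same
    rw [if_pos hyκ', hsame] at key
    exact hy' key

end IsTailedLightFlow

end HeavyBase

end TailedLightFlow

end Literature.AlgebraicGeometry.Resolution.WeightedBlowup
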